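import Literature.Computability.AlgebraicComplexity.FermionicPencil
import Literature.Computability.AlgebraicComplexity.ValiantClassesProofs
import Literature.Computability.AlgebraicComplexity.ValiantHCCompleteness
import Literature.Computability.AlgebraicComplexity.ValiantConjectureCompleteCriterion
import Summits.ValiantsHypothesis.ValiantsHypothesis.Theorems.FermionicJetHcProjectsToCdet
import Summits.ValiantsHypothesis.ValiantsHypothesis.Theorems.FermionicJetJetsInVNP
import Summits.ValiantsHypothesis.ValiantsHypothesis.Theorems.FermionicJetFirstToBounded
import Summits.ValiantsHypothesis.ValiantsHypothesis.Theorems.FermionicJetAssembly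
import Summits.ValiantsHypothesis.ValiantsHypothesis.Theses.FermionicJet
import HarnessLib

/-!
# ValiantsHypothesis / FermionicJet — `cdet` is `VNP`-complete; the open cruxes are equivalent to `VP ≠ VNP`

The two consequences announced in the docstring of item `stmt-ValiantsHypothesis-5342`
(`HcProjectsToCdet`, PROVED: `hcProjectsToCdet_proof`) and in the route's KILL CRITERIA, made
kernel-checked:

* `isVNPFamily_cdetPoly`, `isVNPComplete_cdetPoly` — the cycle-counting determinant
  `cdet_n = ∑_σ sgn σ · c(σ) · ∏ᵢ X_{σ i, i}` (first Taylor coefficient of the fermionic pencil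
  `∑_σ sgn σ · t^{c(σ)} x^σ` at the free-fermion point `t = 1`) is `VNP`-COMPLETE under p-projections
  over `ℂ`: it is p-definable (the order-`1` jet, `jetsInVNP_proof 1` with `cycleJetPoly_one`) and every
  p-definable family is `≤_p HC ≤_p cdet` (Valiant's `isVNPComplete_hcPoly_holds` and the item's
  `hcProjectsToCdet_proof`, composed by `IsPProjection.trans_holds`).
* `valiantsHypothesis_iff_firstOrderHardness` — the route's rank-2 crux `FirstOrderHardness`
  (`cdet ∉ VP`, item 5341) is EQUIVALENT to the summit statement `VP_ℂ ≠ VNP_ℂ`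
  (von zur Gathen 1987, Prop. 4.8 for an arbitrary complete family, tree:
  `VP_eq_VNP_iff_isVPFamily_of_isVNPComplete`).
* `valiantsHypothesis_iff_boundedOrderHardness` — likewise for the rank-0 crux `BoundedOrderHardness`
  (item 5340: some fixed-order jet is not in `VP`): `⇒` through order `1` (`firstToBounded_proof`),
  `⇐` is the route's assembly (`assembly_proof` with `jetsInVNP_proof`).
* `firstOrderHardness_iff_boundedOrderHardness`, `firstOrderHardness_iff_not_isPComputable_cdetPoly` —
  bookkeeping forms (the jet order is irrelevant; for the p-family `cdet`, `∉ VP` = not p-computable).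

So route `FermionicJet` is a NORMAL-FORM route: what remains open in it is Valiant's hypothesis itself,
restated for `cdet`. Nothing here asserts or refutes `VP ≠ VNP`; no named facts are assumed.
-/

noncomputable section

set_option linter.dupNamespace false -- single-conjunct summit: `ValiantsHypothesis.ValiantsHypothesis`

open Literature.Computability.AlgebraicComplexity
open Summit.ValiantsHypothesis.ValiantsHypothesis.Theses.FermionicJet

namespace Summit.ValiantsHypothesis.ValiantsHypothesis.Theorems

namespace FermionicJetCdetVNPComplete

/-! ### `cdet ∈ VNP` and `VNP`-completeness -/

/-- **`cdet` is p-definable over `ℂ`**: the cycle-counting determinant family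
`(cdet_n)_n = (∑_σ sgn σ · c(σ) ∏ᵢ X_{σ i, i})_n` is a `VNP` family — it is the order-`1` cycle jet
(`cycleJetPoly_one`: `binom(c, 1) = c`), and every fixed-order jet is in `VNP` by the route's proved
support `JetsInVNP` (`jetsInVNP_proof`, Valiant's criterion). [folklore] -/
theorem isVNPFamily_cdetPoly : IsVNPFamily (k := ℂ) (fun n => cdetPoly (Fin n) ℂ) := by
  have h : IsVNPFamily (k := ℂ) (fun n => cycleJetPoly (Fin n) ℂ 1) := jetsInVNP_proof 1
  simpa only [cycleJetPoly_one] using h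

/-- **`cdet` is `VNP`-complete under p-projections over `ℂ`** (Bürgisser 2000, Def. 2.8–2.9 form):
`cdet ∈ VNP` (`isVNPFamily_cdetPoly`) and every p-definable family `g` satisfies
`g ≤_p HC ≤_p cdet` — Valiant's completeness of the Hamiltonian cycle family
(`isVNPComplete_hcPoly_holds`) followed by the item's `hcProjectsToCdet_proof` (`HC ≤_p cdet` through
de Rugy-Altherre's averaging graph), composed by transitivity of p-projections
(`IsPProjection.trans_holds`). [folklore] -/
theorem isVNPComplete_cdetPoly : IsVNPComplete (k := ℂ) (fun n => cdetPoly (Fin n) ℂ) := by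
  refine ⟨isVNPFamily_cdetPoly, fun v g hg => ?_⟩
  have hHC : IsPProjection (k := ℂ) (fun n => hcPoly (Fin n) ℂ) (fun n => cdetPoly (Fin n) ℂ) :=
    hcProjectsToCdet_proof
  exact IsPProjection.trans_holds ((isVNPComplete_hcPoly_holds ℂ).2 v g hg) hHC

/-- For the `VNP`-complete family `cdet` over `ℂ`: `VP_ℂ = VNP_ℂ ↔ cdet ∈ VP` ("if `A` is
NP-complete then `P = NP` iff `A ∈ P`", transported; von zur Gathen 1987, Prop. 4.8; tree:
`VP_eq_VNP_iff_isVPFamily_of_isVNPComplete`). [folklore] -/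
theorem VP_eq_VNP_iff_isVPFamily_cdetPoly :
    VP ℂ = VNP ℂ ↔ IsVPFamily (k := ℂ) (fun n => cdetPoly (Fin n) ℂ) :=
  VP_eq_VNP_iff_isVPFamily_of_isVNPComplete isVNPComplete_cdetPoly

/-! ### The route's open cruxes are Valiant's hypothesis -/

/-- **`FirstOrderHardness ⟺ VH`.** The route's rank-2 crux (item `stmt-ValiantsHypothesis-5341`:
the cycle-counting determinant is not a `VP` family over `ℂ`) is EQUIVALENT to the summit statement
`ValiantsHypothesis` (`VP_ℂ ≠ VNP_ℂ`): negate `VP_eq_VNP_iff_isVPFamily_cdetPoly`. This is the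
route's own kill criterion ("`HcProjectsToCdet` proved ⇒ rank 2 ⟺ VH"), now a theorem; it neither
proves nor refutes either side. [folklore] -/
theorem valiantsHypothesis_iff_firstOrderHardness :
    _root_.ValiantsHypothesis ↔ FirstOrderHardness := by
  unfold _root_.ValiantsHypothesis Literature.PNP.ValiantHypothesis FirstOrderHardness
  exact not_congr VP_eq_VNP_iff_isVPFamily_cdetPoly

/-- **`BoundedOrderHardness ⟺ VH`.** The route's rank-0 crux (item `stmt-ValiantsHypothesis-5340`:
for some fixed order `k`, the `k`-th jet family `∑_σ sgn σ · binom(c(σ), k) x^σ` is not in `VP` over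
`ℂ`) is EQUIVALENT to `ValiantsHypothesis`: `⇒` via `FirstOrderHardness` at order `k = 1`
(`valiantsHypothesis_iff_firstOrderHardness`, `firstToBounded_proof`); `⇐` is the route's assembly
(`assembly_proof`) fed with the proved `JetsInVNP` (`jetsInVNP_proof`). [folklore] -/
theorem valiantsHypothesis_iff_boundedOrderHardness :
    _root_.ValiantsHypothesis ↔ BoundedOrderHardness := by
  constructor
  · intro h
    have h1 : FirstOrderHardness := valiantsHypothesis_iff_firstOrderHardness.1 h
    have h2 : FirstToBounded := FermionicJet.firstToBounded_proof
    exact h2 h1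
  · intro h
    have hA : Assembly := FermionicJet.assembly_proof
    exact hA h jetsInVNP_proof

/-- The jet order is irrelevant: `FirstOrderHardness ⟺ BoundedOrderHardness` (both are `VP ≠ VNP`
over `ℂ`). The forward direction alone is the route's support `FirstToBounded`. [folklore] -/
theorem firstOrderHardness_iff_boundedOrderHardness :
    FirstOrderHardness ↔ BoundedOrderHardness :=
  valiantsHypothesis_iff_firstOrderHardness.symm.trans valiantsHypothesis_iff_boundedOrderHardness

/-- `FirstOrderHardness` in von zur Gathen's wording (1987, Prop. 4.8: "Valiant's hypothesis holds
iff the complete family is not p-computable"): since `cdet` is a p-family, `cdet ∉ VP` says exactly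
that `(cdet_n)_n` is not p-computable. [folklore] -/
theorem firstOrderHardness_iff_not_isPComputable_cdetPoly :
    FirstOrderHardness ↔ ¬ IsPComputable (k := ℂ) (fun n => cdetPoly (Fin n) ℂ) := by
  rw [← valiantsHypothesis_iff_firstOrderHardness]
  unfold _root_.ValiantsHypothesis Literature.PNP.ValiantHypothesis
  exact VP_ne_VNP_iff_not_isPComputable_of_isVNPComplete isVNPComplete_cdetPoly

end FermionicJetCdetVNPComplete

end Summit.ValiantsHypothesis.ValiantsHypothesis.Theorems
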